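import Summits.QuantumFields.YangMills.Theses.GronwallGap

/-!
# `GronwallGap.Assembly` — the assembly item of route `GronwallGap`

Route `GronwallGap` (sub-problem `YangMills` of summit `QuantumFields`) files, as its assembly item
`Assembly` (stmt-QuantumFields-8805), the implication chain

`PathGapModulus → AnalyticDetour → StrongCouplingAnchor → WilsonWeightBridge →
 ContinuumFromLatticeGap → YangMills`.

This is *verbatim* the type of the route's deciding theorem
`Summit.QuantumFields.YangMills.Theses.GronwallGap.closes` (planner-authored, sorry-free,
kernel-checked with the route file). Its content is Gronwall bookkeeping: fix `G` compact simple
with `borel G`; `StrongCouplingAnchor` gives `β₀(r)` and `AnalyticDetour` gives the exceptional set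
`E(r)` and `β₁(r)`; anchor at `βs = min β₀ β₁ / 2`, where the anchor supplies a volume-uniform
clustering rate `m₀ > 0` of Wilson(βs); for `β ∉ E` the detour supplies an admissible analytic
weight path `w` with `w 0 = exp(βs Re tr r ·)` and `w 1 = exp(β Re tr r ·)`; `WilsonWeightBridge`
plus the fact that the plaquette-weight measure depends on the weight family only through its value
at the parameter rewrite Wilson(βs)-clustering as `w 0`-clustering and `w 1`-clustering as
Wilson(β)-clustering; one application of the rate-capped `PathGapModulus` with `s = 0`, `s' = 1`
transports the rate to `min m₀ M · e^(−K) / 2 > 0`. That is the hypothesis of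
`ContinuumFromLatticeGap` for every `r`, whose conclusion is the `G`-clause of `YangMills`.
This file closes the item by that definitional unfolding; it adds no mathematics of its own.

Sources: route-internal (the deciding theorem `closes`); Jaffe–Witten 2000/2006 for the clauses
packaged in `YangMills`; Osterwalder–Seiler 1978 for the strong-coupling anchor the chain starts
from.
Deliberately NOT here: any of the cruxes (`PathGapModulus`, `AnalyticDetour`,
`ContinuumFromLatticeGap`), the target `LatticeGapOffTransitions`, or the supports
(`StrongCouplingAnchor`, `WilsonWeightBridge`) — they stay open items of the route.
-/

namespace Summit.QuantumFields.YangMills.Theorems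

/-- **`GronwallGap.Assembly` holds** (assembly item stmt-QuantumFields-8805): the chain
`PathGapModulus → AnalyticDetour → StrongCouplingAnchor → WilsonWeightBridge →
ContinuumFromLatticeGap → YangMills`.
Proof: after unfolding, the goal is literally the type of the route's sorry-free deciding theorem
`GronwallGap.closes` (anchor at `min β₀ β₁ / 2`, one rate-capped modulus step `s = 0 → s' = 1`,
two measure rewrites). [folklore] -/
theorem gronwallGap_assembly_proof :
    Summit.QuantumFields.YangMills.Theses.GronwallGap.Assembly := by
  unfold Summit.QuantumFields.YangMills.Theses.GronwallGap.Assembly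
  exact Summit.QuantumFields.YangMills.Theses.GronwallGap.closes

end Summit.QuantumFields.YangMills.Theorems
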